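import Summits.KontsevichZagierPeriods.KontsevichZagierPeriods.Theses.FermatIsogeny
import Summits.KontsevichZagierPeriods.KontsevichZagierPeriods.Theorems.FermatIsogenyBetaLinearSectorHalfIntegers
import Summits.KontsevichZagierPeriods.KontsevichZagierPeriods.Theorems.TerasomaMultiplicationBetaCancellationOfPiCancellation
import Summits.KontsevichZagierPeriods.KontsevichZagierPeriods.Theorems.BetaCancellation.Negative.EulerReflectionStub
import Literature.NumberTheory.Transcendental.KZProduct
import Literature.NumberTheory.Transcendental.LindemannWeierstrassProofs

/-!
# `BetaLinearSector` on the INTEGER-SUM sector, ALL LEVELS AT ONCE, UNCONDITIONALLY (the Euler sector)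

Crux `BetaLinearSector` (stmt-KontsevichZagierPeriods-3897, route FermatIsogeny): for positive rationals `a b a' b'` and a real algebraic
`c`, two one-dimensional Kontsevich–Zagier representations pinned on `(0,1)` as `[t^{a-1}(1-t)^{b-1}]` and `[c·t^{a'-1}(1-t)^{b'-1}]` with the
same value are KZ-equivalent.  The general crux is closed modulo the named fact `HuberWustholzCurvePeriods` (Huber–Wüstholz 2022, Thm 13.3 (2));
the landed unconditional rungs are LEVEL-bounded (`½ℤ`, `⅓ℤ`, `¼ℤ`, `½ℤ ∪ ⅓ℤ`: Lindemann resp. Chudnovsky).  THIS file proves the crux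
UNCONDITIONALLY on the sector `a + b ∈ ℤ`, `a' + b' ∈ ℤ` — ALL LEVELS AT ONCE (registered anchor `betaLinearSector_integerSums`): the Beta
values of the sector are `B(a, m − a) ∈ ℚ_{>0}·π / sin(πa)` (`a ∉ ℤ`) or rational (`a ∈ ℤ`), i.e. this is the union over all `N` of the
Koblitz–Rohrlich classes with `t ≡ 0 (mod N)` ("reflection pairs = the `d ≤ 1` rational sector" of the crux note).

* MOVE input: **Euler's reflection formula inside the calculus for every rational `a ∈ (0,1)`**,
  `[(0,1), sin(πa)·t^{a-1}(1-t)^{-a}] ∼ [disc, 1]` — item `EulerReflectionRational` (stmt-3383), PROVED in the tree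
  (`BetaCancellationLine.stub_eulerReflection`: `x = s^q/(1+s^q)`, fold, real partial fractions over `ℚ(cos π/q)`, Möbius rotations tiling the
  circle) — together with the landed translation / swap chains of the half-integer file (`pinned_translate`, `pinned_swap`: integration by parts
  and `t ↦ 1 − t` inside the rules) and `β(1,1) ∼ [pt, 1]` (`equivalent_point_one_one`).
* TRANSCENDENCE input: Lindemann only (`π ∉ ℚ̄`, `transcendental_pi_holds`, PROVED in the tree) — to separate the `π`-class from the rational
  class; inside the `π`-class NO transcendence is needed: two cells `[c·β(a,1−a)]`, `[c'·β(a',1−a')]` normalise onto `(c/sin πa)·[π]` and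
  `(c'/sin πa')·[π]`, and equal values force equal constants.

Part I — level reduction keeping the integrality of `a + b` (strong induction on `⌊a⌋ + ⌊b⌋`, `P_of_base_left_intSum`); Part II — the base
cells are `(a, 1 − a)`, `0 < a < 1` (the `π`-class, normal form `nf_reflection`) and `(1, 1)` (the rational class); assembly `P_base_intSum`,
`P_all_intSum`, `betaLinearSector_integerSums`.

References: M. Kontsevich, D. Zagier, *Periods* (2001), §1.2; L. Euler, reflection formula (G. E. Andrews, R. Askey, R. Roy, *Special Functions*
(1999), Thm 1.2.1); F. Lindemann, *Über die Zahl π*, Math. Ann. 20 (1882); N. Koblitz, D. Rohrlich, Canad. J. Math. 30 (1978), p. 1184.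
-/

noncomputable section

namespace Summit.KontsevichZagierPeriods.FermatIsogeny.BetaLinearSector.IntegerSums

open MeasureTheory Set
open Literature.NumberTheory.Transcendental
open Literature.NumberTheory.Transcendental.KZ
open Summit.KontsevichZagierPeriods.FermatIsogeny.BetaLinearSector.HalfIntegers
open Summit.KontsevichZagierPeriods.KontsevichZagierPeriods.BetaCancellationLine (stub_eulerReflection sin_pi_mul_pos)
open Summit.KontsevichZagierPeriods.KontsevichZagierPeriods.BetaCancellationNegative (isAlgebraic_sin_pi_mul_rat)

set_option quotPrecheck false in
/-- `r` is PINNED as `[(0,1), c · t^{a-1}(1-t)^{b-1}]` (the two hypotheses on each representation in the crux, with a constant). -/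
local notation "Pinned⟦" c ", " a ", " b ", " r "⟧" =>
  (IntegralRep.domain r = {x : Fin 1 → ℝ | x 0 ∈ Set.Ioo (0:ℝ) 1} ∧
    Set.EqOn (IntegralRep.integrand r) (fun x : Fin 1 → ℝ => (c : ℝ) * (x 0) ^ (((a : ℚ) : ℝ) - 1) * (1 - x 0) ^ (((b : ℚ) : ℝ) - 1))
      (IntegralRep.domain r))

set_option quotPrecheck false in
/-- The two-sided, constant-carrying form of the crux for fixed exponents: any two representations pinned as `[c·β(a,b)]`,
`[c'·β(a',b')]` (`c, c'` real algebraic) with equal values are KZ-equivalent. -/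
local notation "P⟦" a ", " b ", " a' ", " b' "⟧" =>
  (∀ (c c' : ℝ) (r r' : IntegralRep 1), IsAlgebraic ℚ c → IsAlgebraic ℚ c' →
    Pinned⟦c, a, b, r⟧ → Pinned⟦c', a', b', r'⟧ → IntegralRep.value r = IntegralRep.value r' → Equivalent r r')

/-! ## Part I — level reduction keeping the integrality of `a + b` -/

/-- LEVEL REDUCTION on the left pair, KEEPING `a + b ∈ ℤ`: if `P⟦a₀, b₀, a', b'⟧` holds for all exponents `a₀, b₀ ∈ (0,1]` with
`a₀ + b₀ ∈ ℤ`, it holds for all positive rationals `a, b` with `a + b ∈ ℤ` (strong induction on `⌊a⌋ + ⌊b⌋`, translating and swapping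
with the landed chains `P_lower_left`, `P_swap_left`; both moves change `a + b` by an integer). [folklore] -/
theorem P_of_base_left_intSum {a' b' : ℚ}
    (base : ∀ a b : ℚ, 0 < a → a ≤ 1 → 0 < b → b ≤ 1 → (∃ m : ℤ, a + b = m) → P⟦a, b, a', b'⟧) :
    ∀ a b : ℚ, 0 < a → 0 < b → (∃ m : ℤ, a + b = m) → P⟦a, b, a', b'⟧ := by
  suffices H : ∀ n : ℕ, ∀ a b : ℚ, ⌊a⌋₊ + ⌊b⌋₊ = n → 0 < a → 0 < b → (∃ m : ℤ, a + b = m) → P⟦a, b, a', b'⟧ from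
    fun a b ha hb hm => H _ a b rfl ha hb hm
  intro n
  induction n using Nat.strong_induction_on with
  | _ n ih =>
    intro a b hn ha hb hm
    by_cases hb1 : b ≤ 1
    · by_cases ha1 : a ≤ 1
      · exact base a b ha ha1 hb hb1 hm
      · push Not at ha1
        have ha' : 0 < a - 1 := by linarith
        have hfl : ⌊a⌋₊ = ⌊a - 1⌋₊ + 1 := by
          conv_lhs => rw [← sub_add_cancel a 1]
          exact Nat.floor_add_one ha'.le
        have hlt : ⌊b⌋₊ + ⌊a - 1⌋₊ < n := by omega
        have hm' : ∃ m : ℤ, b + (a - 1) = m := by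
          obtain ⟨m, hm⟩ := hm
          exact ⟨m - 1, by push_cast; linarith⟩
        have hP : P⟦b, (a - 1), a', b'⟧ := ih _ hlt b (a - 1) rfl hb ha' hm'
        have hP' : P⟦b, a, a', b'⟧ := by simpa using P_lower_left hb ha' hP
        exact P_swap_left ha hb hP'
    · push Not at hb1
      have hb' : 0 < b - 1 := by linarith
      have hfl : ⌊b⌋₊ = ⌊b - 1⌋₊ + 1 := by
        conv_lhs => rw [← sub_add_cancel b 1]
        exact Nat.floor_add_one hb'.le
      have hlt : ⌊a⌋₊ + ⌊b - 1⌋₊ < n := by omega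
      have hm' : ∃ m : ℤ, a + (b - 1) = m := by
        obtain ⟨m, hm⟩ := hm
        exact ⟨m - 1, by push_cast; linarith⟩
      have hP : P⟦a, (b - 1), a', b'⟧ := ih _ hlt a (b - 1) rfl ha hb' hm'
      simpa using P_lower_left ha hb' hP

/-! ## Part II — the base cells: the `π`-class `(a, 1 − a)` and the rational class `(1, 1)` -/

/-- The base cells of the integer-sum sector: exponents `a, b ∈ (0,1]` with `a + b ∈ ℤ` are a REFLECTION PAIR `(a, 1 − a)`, `0 < a < 1`,
or the cell `(1, 1)`. [folklore] -/
theorem base_cases {a b : ℚ} (ha : 0 < a) (ha1 : a ≤ 1) (hb : 0 < b) (hb1 : b ≤ 1) (hm : ∃ m : ℤ, a + b = m) :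
    (a < 1 ∧ b = 1 - a) ∨ (a = 1 ∧ b = 1) := by
  obtain ⟨m, hm⟩ := hm
  have h1 : (0 : ℚ) < m := by rw [← hm]; linarith
  have h2 : (m : ℚ) ≤ 2 := by rw [← hm]; linarith
  have h1' : 0 < m := by exact_mod_cast h1
  have h2' : m ≤ 2 := by exact_mod_cast h2
  interval_cases m
  · left
    push_cast at hm
    exact ⟨by linarith, by linarith⟩
  · right
    push_cast at hm
    exact ⟨by linarith, by linarith⟩

/-- THE `π`-CLASS IN NORMAL FORM — **Euler's reflection inside the rules**: a cell `[c·t^{a-1}(1-t)^{-a}]`, `0 < a < 1` rational, is a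
chain of moves away from `(c / sin πa)·[π]` (`[π]` = the closed unit disc with integrand `1`, `KZ.piRep`), and its value is `c·π / sin πa`.
The chain is `EulerReflectionRational` (stmt-3383, PROVED in the tree as `BetaCancellationLine.stub_eulerReflection`) for the cell with constant
`sin πa`, transported through the algebraic scalar `c / sin πa` (rule 1b). [cite: KontsevichZagier2001, §1.2] [cite: AndrewsAskeyRoy1999, Thm 1.2.1] -/
theorem nf_reflection {c : ℝ} {a : ℚ} (ha : 0 < a) (ha1 : a < 1) {r : IntegralRep 1}
    (hr : Pinned⟦c, a, (1 - a), r⟧) (hk : IsAlgebraic ℚ (c * (Real.sin (Real.pi * a))⁻¹)) :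
    Equivalent r (piRep.constMul (c * (Real.sin (Real.pi * a))⁻¹) hk) ∧
      r.value = c * (Real.sin (Real.pi * a))⁻¹ * Real.pi := by
  set s : ℝ := Real.sin (Real.pi * a) with hs_def
  have hs : IsAlgebraic ℚ s := isAlgebraic_sin_pi_mul_rat ha
  have hs0 : s ≠ 0 := (sin_pi_mul_pos ha ha1).ne'
  -- the Euler cell with constant `sin πa`
  obtain ⟨R, hR⟩ := exists_pinned s hs ha (by linarith : 0 < 1 - a)
  have eR : Equivalent R piRep := by
    refine stub_eulerReflection a ha ha1 R piRep hR.1 (fun x hx => ?_) rfl (fun _ _ => rfl)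
    rw [hR.2 hx, hs_def]
    push_cast
    ring_nf
  -- transport through `c / sin πa`
  have e₁ : Equivalent r (R.constMul (c * s⁻¹) hk) :=
    equivalent_constMul_of_pinned hk hr hR (by field_simp)
  have e : Equivalent r (piRep.constMul (c * s⁻¹) hk) := e₁.trans (eR.constMul (c * s⁻¹) hk)
  refine ⟨e, ?_⟩
  rw [Equivalent.value_eq_holds e, IntegralRep.value_constMul, piRep_value]

/-- THE RATIONAL CLASS: a cell `[c·β(1,1)] = [(0,1), c]` is a chain of moves away from the point representation `[pt, c]` and has value `c`.
[cite: KontsevichZagier2001, §1.2 rule (3)] -/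
theorem nf_one_one {c : ℝ} (hc : IsAlgebraic ℚ c) {r : IntegralRep 1} (hr : Pinned⟦c, (1 : ℚ), (1 : ℚ), r⟧) :
    Equivalent r (IntegralRep.unit.constMul (c * 1) (hc.mul isAlgebraic_one)) ∧ r.value = c := by
  have e := equivalent_point_one_one hc hr
  refine ⟨e, ?_⟩
  rw [Equivalent.value_eq_holds e, IntegralRep.value_constMul, IntegralRep.value_unit, mul_one, mul_one]

/-- **The base of the integer-sum sector**: `P⟦a, b, a', b'⟧` for base cells on both sides — two `π`-cells normalise onto the SAME multiple of
`[π]` (equal values, `π ≠ 0`), two rational cells onto the same point representation, a `π`-cell never has the value of a rational cell with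
non-zero algebraic constants (LINDEMANN, `transcendental_pi_holds`), and the degenerate constants `c = 0` give two zero representations.
[cite: KontsevichZagier2001, §1.2] -/
theorem P_base_intSum {a b a' b' : ℚ} (ha : 0 < a) (ha' : 0 < a')
    (hab : (a < 1 ∧ b = 1 - a) ∨ (a = 1 ∧ b = 1)) (hab' : (a' < 1 ∧ b' = 1 - a') ∨ (a' = 1 ∧ b' = 1)) : P⟦a, b, a', b'⟧ := by
  have hb : 0 < b := by rcases hab with ⟨h1, rfl⟩ | ⟨-, rfl⟩ <;> linarith
  have hb' : 0 < b' := by rcases hab' with ⟨h1, rfl⟩ | ⟨-, rfl⟩ <;> linarith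
  intro c c' r r' hc hc' hr hr' hv
  have hvr := value_of_pinned hr ha hb
  have hvr' := value_of_pinned hr' ha' hb'
  have hBpos : ∀ {p q : ℚ}, 0 < p → 0 < q →
      0 < Real.Gamma (p:ℝ) * Real.Gamma (q:ℝ) / Real.Gamma ((p:ℝ) + (q:ℝ)) := fun {p q} hp hq => by
    have hpR : (0:ℝ) < p := by exact_mod_cast hp
    have hqR : (0:ℝ) < q := by exact_mod_cast hq
    exact div_pos (mul_pos (Real.Gamma_pos_of_pos hpR) (Real.Gamma_pos_of_pos hqR)) (Real.Gamma_pos_of_pos (by linarith))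
  -- the degenerate constants
  by_cases hc0 : c = 0
  · have hc'0 : c' = 0 := by
      have h0 : c' * (Real.Gamma (a':ℝ) * Real.Gamma (b':ℝ) / Real.Gamma ((a':ℝ) + (b':ℝ))) = 0 := by
        rw [← hvr', ← hv, hvr, hc0, zero_mul]
      exact (mul_eq_zero.1 h0).resolve_right (hBpos ha' hb').ne'
    have h1 : of r ∈ relations := of_mem_relations_of_eqOn_zero r fun x hx => by
      rw [hr.2 hx]
      simp [hc0]
    have h2 : of r' ∈ relations := of_mem_relations_of_eqOn_zero r' fun x hx => by
      rw [hr'.2 hx]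
      simp [hc'0]
    exact relations.sub_mem h1 h2
  have hc'0 : c' ≠ 0 := by
    intro h
    have h0 : c * (Real.Gamma (a:ℝ) * Real.Gamma (b:ℝ) / Real.Gamma ((a:ℝ) + (b:ℝ))) = 0 := by
      rw [← hvr, hv, hvr', h, zero_mul]
    exact hc0 ((mul_eq_zero.1 h0).resolve_right (hBpos ha hb).ne')
  have hπ : ¬ IsAlgebraic ℚ Real.pi := transcendental_pi_holds
  rcases hab with ⟨ha1, rfl⟩ | ⟨rfl, rfl⟩ <;> rcases hab' with ⟨ha'1, rfl⟩ | ⟨rfl, rfl⟩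
  · -- π-class on both sides: the same multiple of `[π]`
    have hs : IsAlgebraic ℚ (Real.sin (Real.pi * a)) := isAlgebraic_sin_pi_mul_rat ha
    have hs' : IsAlgebraic ℚ (Real.sin (Real.pi * a')) := isAlgebraic_sin_pi_mul_rat ha'
    have hk : IsAlgebraic ℚ (c * (Real.sin (Real.pi * a))⁻¹) := hc.mul hs.inv
    have hk' : IsAlgebraic ℚ (c' * (Real.sin (Real.pi * a'))⁻¹) := hc'.mul hs'.inv
    obtain ⟨e, hval⟩ := nf_reflection ha ha1 hr hk
    obtain ⟨e', hval'⟩ := nf_reflection ha' ha'1 hr' hk'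
    have hkk : c * (Real.sin (Real.pi * a))⁻¹ = c' * (Real.sin (Real.pi * a'))⁻¹ := by
      have h := hv
      rw [hval, hval'] at h
      exact mul_right_cancel₀ Real.pi_pos.ne' h
    have emid : Equivalent (piRep.constMul (c * (Real.sin (Real.pi * a))⁻¹) hk)
        (piRep.constMul (c' * (Real.sin (Real.pi * a'))⁻¹) hk') :=
      of_sub_of_mem_relations_of_eqOn rfl fun x _ => by simp only [IntegralRep.integrand_constMul, hkk]
    exact e.trans (emid.trans e'.symm)
  · -- π-class versus rational class: Lindemann
    exfalso
    have hs : IsAlgebraic ℚ (Real.sin (Real.pi * a)) := isAlgebraic_sin_pi_mul_rat ha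
    have hs0 : Real.sin (Real.pi * a) ≠ 0 := (sin_pi_mul_pos ha ha1).ne'
    have hk : IsAlgebraic ℚ (c * (Real.sin (Real.pi * a))⁻¹) := hc.mul hs.inv
    obtain ⟨-, hval⟩ := nf_reflection ha ha1 hr hk
    obtain ⟨-, hval'⟩ := nf_one_one hc' hr'
    have h := hv
    rw [hval, hval'] at h
    -- `π = c' sin(πa) / c` is algebraic
    have hpi : Real.pi = c' * Real.sin (Real.pi * a) / c := by
      field_simp
      field_simp at h
      linarith
    exact hπ (hpi ▸ ((hc'.mul hs).mul hc.inv))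
  · -- rational class versus π-class: Lindemann
    exfalso
    have hs' : IsAlgebraic ℚ (Real.sin (Real.pi * a')) := isAlgebraic_sin_pi_mul_rat ha'
    have hs'0 : Real.sin (Real.pi * a') ≠ 0 := (sin_pi_mul_pos ha' ha'1).ne'
    have hk' : IsAlgebraic ℚ (c' * (Real.sin (Real.pi * a'))⁻¹) := hc'.mul hs'.inv
    obtain ⟨-, hval⟩ := nf_one_one hc hr
    obtain ⟨-, hval'⟩ := nf_reflection ha' ha'1 hr' hk'
    have h := hv
    rw [hval, hval'] at h
    have hpi : Real.pi = c * Real.sin (Real.pi * a') / c' := by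
      field_simp
      field_simp at h
      linarith
    exact hπ (hpi ▸ ((hc.mul hs').mul hc'.inv))
  · -- rational class on both sides: a common point representation
    obtain ⟨e, hval⟩ := nf_one_one hc hr
    obtain ⟨e', hval'⟩ := nf_one_one hc' hr'
    have hcc : c = c' := by rw [← hval, ← hval', hv]
    subst hcc
    exact e.trans e'.symm

/-- **`P⟦a, b, a', b'⟧` on the whole integer-sum sector**: reduce the right pair, then the left pair, to the base cells
(`P_of_base_left_intSum`, keeping the integrality of the sums) and apply `P_base_intSum`. [folklore] -/
theorem P_all_intSum {a b a' b' : ℚ} (ha : 0 < a) (hb : 0 < b) (ha' : 0 < a') (hb' : 0 < b')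
    (hm : ∃ m : ℤ, a + b = m) (hm' : ∃ m : ℤ, a' + b' = m) : P⟦a, b, a', b'⟧ := by
  refine P_of_base_left_intSum (fun a₀ b₀ ha₀ ha₀1 hb₀ hb₀1 hm₀ => ?_) a b ha hb hm
  refine P_symm (P_of_base_left_intSum (a' := a₀) (b' := b₀) (fun a₁ b₁ ha₁ ha₁1 hb₁ hb₁1 hm₁ => ?_) a' b' ha' hb' hm')
  exact P_base_intSum ha₁ ha₀ (base_cases ha₁ ha₁1 hb₁ hb₁1 hm₁) (base_cases ha₀ ha₀1 hb₀ hb₀1 hm₀)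

/-- **`BetaLinearSector` ON THE INTEGER-SUM SECTOR — ALL LEVELS AT ONCE, UNCONDITIONALLY**: Conjecture 1 of Kontsevich–Zagier for every pair of
Beta integrals `[∫₀¹ t^{a-1}(1-t)^{b-1}dt]`, `[∫₀¹ c·t^{a'-1}(1-t)^{b'-1}dt]` with positive rational exponents, `a + b ∈ ℤ`, `a' + b' ∈ ℤ`, `c` real
algebraic, and equal values — the registered anchor `betaLinearSector_integerSums` of crux stmt-3897 (its statement restricted by the two
integrality hypotheses; every level `N` at once).  Inputs: Euler's reflection inside the rules for every rational argument (`stub_eulerReflection`,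
item stmt-3383), the proved translation/reflection chains, `β(1,1) ∼ [pt, 1]`, and Lindemann's theorem (`transcendental_pi_holds`).
[cite: KontsevichZagier2001, §1.2] [cite: AndrewsAskeyRoy1999, Thm 1.2.1] -/
theorem betaLinearSector_integerSums : ∀ (a b a' b' : ℚ) (c : ℝ), 0 < a → 0 < b → 0 < a' → 0 < b' → IsAlgebraic ℚ c →
    (∃ m : ℤ, a + b = m) → (∃ m : ℤ, a' + b' = m) →
    ∀ (r r' : KZ.IntegralRep 1), r.domain = {x | x 0 ∈ Set.Ioo (0:ℝ) 1} →
    Set.EqOn r.integrand (fun x => (x 0) ^ ((a:ℝ) - 1) * (1 - x 0) ^ ((b:ℝ) - 1)) r.domain →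
    r'.domain = {x | x 0 ∈ Set.Ioo (0:ℝ) 1} →
    Set.EqOn r'.integrand (fun x => c * (x 0) ^ ((a':ℝ) - 1) * (1 - x 0) ^ ((b':ℝ) - 1)) r'.domain →
    r.value = r'.value → KZ.Equivalent r r' := by
  intro a b a' b' c ha hb ha' hb' hc hm hm' r r' hd hi hd' hi' hv
  refine P_all_intSum ha hb ha' hb' hm hm' 1 c r r' isAlgebraic_one hc ⟨hd, fun x hx => ?_⟩ ⟨hd', hi'⟩ hv
  simp only [hi hx, one_mul]

end Summit.KontsevichZagierPeriods.FermatIsogeny.BetaLinearSector.IntegerSums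

end
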